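import Literature.NumberTheory.EllipticCurves.RankinSelbergWeightOneStrip
import Literature.NumberTheory.EllipticCurves.Gamma0EisensteinWeightOneContinuation
import HarnessLib

/-!
# The weight-`(2, 1)` Rankin–Selberg identity with Hecke's continued Eisenstein series

Topic `Literature/NumberTheory/EllipticCurves`; namespace
`Literature.NumberTheory.EllipticCurves.ModularForms`. Theorems only; no definition, no named fact.

For an odd Dirichlet character `ψ mod N`, a weight-`2` form `φ` with trivial character and a
weight-`1` form `F` with character `ψ` on `Γ₀(N)`, and Hecke's continuation
`G̃_ψ(τ, s) = L(ψ, 1+2s) E₁,ψ(τ, s)` (`eisensteinOneCont`, equal to that product for `Re s > 1/2`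
and holomorphic on `Re s > -1/2`), the Rankin–Selberg integral over the domain
`F = ⋃_q g_q⁻¹ 𝒟ᵒ` of `Γ₀(N)` (`Gamma0RankinSelbergUnfolding`)

`J(s) = ∫_F \overline{G̃_ψ(τ, s̄)} φ(τ) \overline{F(τ)} (Im τ)² dμ`

unfolds on the half-plane of absolute convergence:

* `integral_domain_conj_eisensteinOneCont_mul_eq` — for `Re s > 1/2` and `φ F̄ y^{s+2} ∈ L¹(P)`,
  `J(s) = \overline{L(ψ, 1 + 2s̄)} · 2 ∫_P φ F̄ y^{s+2} dμ` (`P = {0 ≤ Re < 1}`; the tree's unfolding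
  `integral_domain_conj_eisensteinOne_mul_eq` and `G̃ = L · E₁` on `Re s > 1/2`);
* `integral_domain_conj_eisensteinOneCont_mul_eq_tsum` — with `q`-expansions `φ = Σ a(m) qᵐ`
  (`a(0) = 0`), `F = Σ b(m) qᵐ`, polynomially bounded coefficients and the global growth bounds
  `|φ| ≤ C e^{-2πy}(1 + y^{-A'})`, `|F| ≤ C (y^A + y^{-A})`, for `Re s` large:
  `J(s) = \overline{L(ψ, 1 + 2s̄)} · 2 Γ(s+1) Σ_{m ≥ 1} a(m) \overline{b(m)} (4πm)^{-(s+1)}`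
  (the strip integral of `RankinSelbergWeightOneStrip`).

Together with the holomorphy of `J` on `Re s > -1/2` (`EisensteinWeightOneDomainBounds`) this is
the analytic continuation of the Rankin–Selberg Dirichlet series `Σ a(m) \overline{b(m)} m^{-w}`
times `L(ψ̄, 2w - 1) Γ(w)`, to `Re w > 1/2`, with the value at `w = 1` given by the Petersson-type
integral `J(0) = ∫_F \overline{G̃_ψ(τ, 0)} φ F̄ y² dμ` (Rankin 1939, §4; Shimura 1976, §2).
Everything is proved. [folklore]

## References

* R. A. Rankin, Proc. Cambridge Philos. Soc. 35 (1939), 357–372, §4.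
* G. Shimura, *The special values of the zeta functions associated with cusp forms*, Comm. Pure
  Appl. Math. 29 (1976), 783–804, §2 (2.3)–(2.5).
-/

noncomputable section

open scoped MatrixGroups ModularForm Modular ENNReal NNReal ComplexConjugate
open MeasureTheory Set Filter Real ModularGroup CongruenceSubgroup
open UpperHalfPlane hiding I
open Literature.NumberTheory.Automorphic (stripFD measurableSet_stripFD)

namespace Literature.NumberTheory.EllipticCurves.ModularForms

variable {N : ℕ} (ψ : DirichletCharacter ℂ N)

section Unfolding

variable (g : (↥𝒮ℒ ⧸ (Gamma0 N : Subgroup (GL (Fin 2) ℝ)).subgroupOf 𝒮ℒ) → SL(2, ℤ))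
  (hg : ∀ q, (Matrix.SpecialLinearGroup.mapGL ℝ (g q) : GL (Fin 2) ℝ) =
    ((q.out : ↥𝒮ℒ) : GL (Fin 2) ℝ))
variable (γ : {v : Fin 2 → ℤ // IsCoprime (v 0) (v 1) ∧ (N : ℤ) ∣ v 0} → SL(2, ℤ))
  (hγ : ∀ v, (γ v) 1 0 = v.1 0 ∧ (γ v) 1 1 = v.1 1)
variable [Fintype (↥𝒮ℒ ⧸ (Gamma0 N : Subgroup (GL (Fin 2) ℝ)).subgroupOf 𝒮ℒ)]
include hg hγ

/-- **Rankin–Selberg unfolding with the continued Eisenstein series** (`Re s > 1/2`): for odd `ψ`,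
`φ` of weight `2` and trivial character, `F` of weight `1` and character `ψ` on `Γ₀(N)` (both
measurable) and `φ F̄ y^{Re s + 2} ∈ L¹(P)`,
`∫_F \overline{G̃_ψ(τ, s̄)} φ F̄ y² dμ = \overline{L(ψ, 1 + 2s̄)} · 2 ∫_P φ F̄ y^{s+2} dμ`. [folklore] -/
theorem integral_domain_conj_eisensteinOneCont_mul_eq [NeZero N] (hodd : ψ.Odd) (φ F : ℍ → ℂ)
    (hφm : Measurable φ) (hFm : Measurable F)
    (hφ : ∀ A : SL(2, ℤ), A ∈ Gamma0 N → ∀ τ : ℍ, φ (A • τ) = denom A τ ^ 2 * φ τ)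
    (hF : ∀ A : SL(2, ℤ), A ∈ Gamma0 N → ∀ τ : ℍ, F (A • τ) = ψ (A 1 1) * denom A τ * F τ)
    {s : ℂ} (hs : 1 / 2 < s.re)
    (hfin : ∫⁻ ρ in {ρ : ℍ | 0 ≤ ρ.re ∧ ρ.re < 1}, ‖rsIntegrand φ F s ρ‖ₑ < ∞) :
    ∫ τ in ⋃ q, {τ : ℍ | g q • τ ∈ 𝒟ᵒ},
        conj (eisensteinOneCont ψ τ (conj s)) * (φ τ * conj (F τ) * ((τ.im : ℝ) : ℂ) ^ 2) =
      conj (ψ.LFunction (1 + 2 * conj s)) *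
        (2 * ∫ ρ in {ρ : ℍ | 0 ≤ ρ.re ∧ ρ.re < 1}, rsIntegrand φ F s ρ) := by
  have hs' : 1 / 2 < (conj s).re := by simpa using hs
  have h1 : ∀ τ : ℍ, conj (eisensteinOneCont ψ τ (conj s)) * (φ τ * conj (F τ) * ((τ.im : ℝ) : ℂ) ^ 2) =
      conj (ψ.LFunction (1 + 2 * conj s)) *
        (conj (eisensteinOne ψ τ (conj s)) * (φ τ * conj (F τ) * ((τ.im : ℝ) : ℂ) ^ 2)) := by
    intro τ
    rw [eisensteinOneCont_eq_LFunction_mul ψ hodd hs' τ, map_mul]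
    ring
  simp_rw [h1]
  rw [MeasureTheory.integral_const_mul,
    integral_domain_conj_eisensteinOne_mul_eq ψ g hg γ hγ φ F hφm hFm hφ hF s hfin]

/-- **The unfolded identity as a Dirichlet series**: with `q`-expansions `φ = Σ a(m) qᵐ`
(`a(0) = 0`), `F = Σ b(m) qᵐ`, `|a(m)|, |b(m)| ≤ C (m+1)ᵏ`, the global bounds
`|φ(τ)| ≤ C_φ e^{-2π Im τ} (1 + (Im τ)^{-A'})`, `|F(τ)| ≤ C_F ((Im τ)^A + (Im τ)^{-A})`, and
`Re s > max(1/2, 2k, A + A' - 1)`: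
`∫_F \overline{G̃_ψ(τ, s̄)} φ F̄ y² dμ
  = \overline{L(ψ, 1 + 2s̄)} · 2 Γ(s+1) Σ_{m ≥ 1} a(m) \overline{b(m)} (4πm)^{-(s+1)}`. [folklore] -/
theorem integral_domain_conj_eisensteinOneCont_mul_eq_tsum [NeZero N] (hodd : ψ.Odd)
    {a b : ℕ → ℂ} {Ca Cb : ℝ} {k : ℕ}
    (ha : ∀ m, ‖a m‖ ≤ Ca * ((m : ℝ) + 1) ^ k) (hb : ∀ m, ‖b m‖ ≤ Cb * ((m : ℝ) + 1) ^ k)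
    (ha0 : a 0 = 0) (φ F : ℍ → ℂ) (hφq : ∀ τ : ℍ, φ τ = qSeries a τ)
    (hFq : ∀ τ : ℍ, F τ = qSeries b τ) (hφm : Measurable φ) (hFm : Measurable F)
    (hφ : ∀ A : SL(2, ℤ), A ∈ Gamma0 N → ∀ τ : ℍ, φ (A • τ) = denom A τ ^ 2 * φ τ)
    (hF : ∀ A : SL(2, ℤ), A ∈ Gamma0 N → ∀ τ : ℍ, F (A • τ) = ψ (A 1 1) * denom A τ * F τ)
    {Cφ CF A Aφ : ℝ} (hA : 0 ≤ A) (hAφ : 0 ≤ Aφ)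
    (hφb : ∀ τ : ℍ, ‖φ τ‖ ≤ Cφ * Real.exp (-(2 * π * τ.im)) * (1 + τ.im ^ (-Aφ)))
    (hFb : ∀ τ : ℍ, ‖F τ‖ ≤ CF * (τ.im ^ A + τ.im ^ (-A)))
    {s : ℂ} (hs₁ : 1 / 2 < s.re) (hs₂ : 2 * k < s.re) (hs₃ : A + Aφ - 1 < s.re) :
    ∫ τ in ⋃ q, {τ : ℍ | g q • τ ∈ 𝒟ᵒ},
        conj (eisensteinOneCont ψ τ (conj s)) * (φ τ * conj (F τ) * ((τ.im : ℝ) : ℂ) ^ 2) =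
      conj (ψ.LFunction (1 + 2 * conj s)) * (2 * (Complex.Gamma (s + 1) *
        ∑' m : ℕ, a (m + 1) * conj (b (m + 1)) *
          (1 / ((4 * π * ((m : ℝ) + 1) : ℝ) : ℂ)) ^ (s + 1))) := by
  have hint : IntegrableOn (rsIntegrand φ F s) stripFD :=
    integrableOn_rsIntegrand_stripFD hφm hFm hA hAφ hφb hFb hs₃
  have hfin : ∫⁻ ρ in {ρ : ℍ | 0 ≤ ρ.re ∧ ρ.re < 1}, ‖rsIntegrand φ F s ρ‖ₑ < ∞ := hint.2
  rw [integral_domain_conj_eisensteinOneCont_mul_eq ψ g hg γ hγ hodd φ F hφm hFm hφ hF hs₁ hfin,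
    show {ρ : ℍ | 0 ≤ ρ.re ∧ ρ.re < 1} = stripFD from rfl,
    setIntegral_stripFD_rsIntegrand_qSeries ha hb ha0 φ F hφq hFq hs₂ hint]

end Unfolding

end Literature.NumberTheory.EllipticCurves.ModularForms
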